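import Literature.NumberTheory.GaloisRepresentations.LubinTateComparison
import Literature.NumberTheory.GaloisRepresentations.UnramifiedLang
import Literature.NumberTheory.GaloisRepresentations.LubinTateField
import Literature.NumberTheory.GaloisRepresentations.LubinTateCharacterLimit
import HarnessLib

/-!
# Lubin–Tate's `ϑ` over `𝒪̂_{F^nr}`: comparison of `F_π` and `F_{uπ}` over the completed maximal unramified extension

Topic `NumberTheory/GaloisRepresentations`; namespace `Literature.NumberTheory.GaloisRepresentations`.
Specialisation of the abstract comparison series of `LubinTateComparison.lean` to the situation of
Lubin–Tate 1965, p. 385 / Cassels–Fröhlich VI §3.7: `F` a non-archimedean local field, `π` a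
uniformiser, `u ∈ 𝒪_Fˣ`, `f = πX + X^q` and `f' = π'X + X^q` (`π' = uπ`) the Lubin–Tate
polynomials (`ltPoly`), `A = 𝒪̂_{F^nr} = maxUnramifiedCompletion F` (tree `UnramifiedCompletion`)
with the automorphism `φ = galAut σ₀` of an arithmetic Frobenius `σ₀` (`IsAbsArithFrob`):

* `isTwistBase_galAut` — `(𝒪̂_{F^nr}, π, q, galAut σ₀)` satisfies the hypotheses `IsTwistBase` of
  the twisted Lubin–Tate lemma (`π` regular, `p ∈ π𝒪̂`, `σ₀ π = π`, `σ₀ x ≡ x^q mod π` — tree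
  `IsAbsArithFrob.galAut_sub_pow_mem_maximalIdeal`), and `isAdicComplete_span_unrPi`;
* `exists_unit_galAut_eq_mul` — **a unit `ε ∈ 𝒪̂_{F^nr}` with `σ₀(ε) = u ε`** (rank-one case of
  the tree's Lang theorem `IsAbsArithFrob.exists_isUnit_eq_mul_galAut`);
* `ltComparison hπ hσ₀ u hε = ϑ` — **Lubin–Tate's series** with `ϑ ≡ εX`, **`f' ∘ ϑ = ϑ^{σ₀} ∘ f`**
  (`subst_ltComparison`), **`ϑ^{σ₀} = ϑ ∘ [u]_f`** (`map_ltComparison`, Lubin–Tate (16)) and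
  **`ϑ ∘ [a]_f = [a]_{f'} ∘ ϑ`** (`subst_hom_ltComparison`, Lubin–Tate (18)); `isLTRing_unit_mul`
  (`uπ` is again a Lubin–Tate base).

This is the formal-group half of Lubin–Tate's proof that the reciprocity map is independent of
`π` and that `(u, F_π/F)` acts on the `π`-power torsion through `[u⁻¹]_f` (their Thm. 3 / Cor.;
Cassels–Fröhlich VI §3.7 Thm. 3); the evaluation at torsion points in `ℂ_F` and the Galois
bookkeeping are the sequel.  No named facts.

## References

* [LubinTate1965] J. Lubin, J. Tate, *Formal complex multiplication in local fields*, Ann. of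
  Math. 81 (1965), pp. 385–386.
* [CasselsFrohlichANT1967] J.-P. Serre, *Local class field theory*, Ch. VI of Cassels–Fröhlich
  (1967), §3.7 Lemma 1, Thm. 3.
* [SerreLocalFields1979] J.-P. Serre, *Local Fields*, Ch. II §5, Ch. XIII §5 (Lang's theorem).
-/

noncomputable section

open MvPowerSeries

namespace Literature.NumberTheory.GaloisRepresentations

/-! ### Specialisation: `A = 𝒪̂_{F^nr}` with its Frobenius -/

section Unramified

open ValuativeRel IsLocalRing Field IsNonarchimedeanLocalField LubinTate

variable {F : Type} [Field F] [ValuativeRel F] [TopologicalSpace F] [IsNonarchimedeanLocalField F]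
variable {π : 𝒪[F]} (hπ : (valuation F).IsUniformizer (π : F))

include hπ in
/-- A uniformiser of `𝒪[F]` is irreducible. [folklore] -/
theorem irreducible_of_isUniformizer' : Irreducible π :=
  IsDiscreteValuationRing.irreducible_of_span_eq_maximalIdeal π
    (fun h => hπ.ne_zero (by rw [h]; rfl)) (maximalIdeal_eq_span_singleton hπ)

/-- Notation-free abbreviation: `π̂`, the image of `π` in `𝒪̂_{F^nr}`. [folklore] -/
abbrev unrPi (π : 𝒪[F]) : maxUnramifiedCompletion F := algebraMap 𝒪[F] (maxUnramifiedCompletion F) π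

include hπ in
/-- `𝒪̂_{F^nr}` is `(π)`-adically complete and separated. [cite: SerreLocalFields1979, Ch. II §5] -/
theorem isAdicComplete_span_unrPi : IsAdicComplete (Ideal.span {unrPi π}) (maxUnramifiedCompletion F) := by
  rw [← maxUnramifiedCompletion.maximalIdeal_eq_span_uniformizer (irreducible_of_isUniformizer' hπ)]
  infer_instance

include hπ in
/-- **`(𝒪̂_{F^nr}, π, q, σ₀)` is a twisted Lubin–Tate base** for every arithmetic Frobenius `σ₀`:
`π` is a non-zero-divisor, `p ∈ π𝒪̂`, `σ₀(π) = π` and `σ₀(x) ≡ x^q (mod π)`.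
[cite: LubinTate1965, Lemma p. 385] [cite: SerreLocalFields1979, Ch. II §5] -/
theorem isTwistBase_galAut {σ₀ : absoluteGaloisGroup F} (hσ₀ : IsAbsArithFrob σ₀) :
    IsTwistBase (unrPi π) (residueFieldCard F)
      (maxUnramifiedCompletion.galAut F σ₀).toRingHom := by
  have hirr := irreducible_of_isUniformizer' hπ
  have hspan := maxUnramifiedCompletion.maximalIdeal_eq_span_uniformizer (F := F) hirr
  refine ⟨fun x hx => ?_, ?_, ?_, fun a => ?_⟩
  · exact (mul_eq_zero.mp hx).resolve_left (maxUnramifiedCompletion.algebraMap_uniformizer_ne_zero hirr)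
  · obtain ⟨p, r, hp, hq, hpmem⟩ := (isLTRing_integer F hπ).exists_prime
    refine ⟨p, r, hp, hq, ?_⟩
    rw [Ideal.mem_span_singleton] at hpmem ⊢
    have h := map_dvd (algebraMap 𝒪[F] (maxUnramifiedCompletion F)) hpmem
    rwa [map_natCast] at h
  · exact maxUnramifiedCompletion.galAut_algebraMap σ₀ π
  · rw [← Ideal.mem_span_singleton, ← hspan]
    exact IsAbsArithFrob.galAut_sub_pow_mem_maximalIdeal hσ₀ a

/-- **The unit `ε` with `σ₀(ε) = u·ε`** exists in `𝒪̂_{F^nr}` for every `u ∈ 𝒪_Fˣ` (Lang's theorem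
in rank one, tree `IsAbsArithFrob.exists_isUnit_eq_mul_galAut`; Lubin–Tate 1965, p. 385: "there is
a unit `ε` with `ε^φ = εu`"). [cite: LubinTate1965, Lemma p. 385] -/
theorem exists_unit_galAut_eq_mul {σ₀ : absoluteGaloisGroup F} (hσ₀ : IsAbsArithFrob σ₀) (u : 𝒪[F]ˣ) :
    ∃ ε : (maxUnramifiedCompletion F)ˣ,
      maxUnramifiedCompletion.galAut F σ₀ (ε : maxUnramifiedCompletion F) =
        algebraMap 𝒪[F] (maxUnramifiedCompletion F) (u : 𝒪[F]) * (ε : maxUnramifiedCompletion F) := by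
  set a : maxUnramifiedCompletion F := algebraMap 𝒪[F] (maxUnramifiedCompletion F) ((u⁻¹ : 𝒪[F]ˣ) : 𝒪[F])
  have ha : IsUnit a := (Units.isUnit u⁻¹).map (algebraMap 𝒪[F] (maxUnramifiedCompletion F))
  have hG : IsUnit (Matrix.of fun (_ _ : Fin 1) => a) := by
    rw [Matrix.isUnit_iff_isUnit_det, Matrix.det_fin_one]; exact ha
  obtain ⟨X, hXu, hX⟩ := IsAbsArithFrob.exists_isUnit_eq_mul_galAut hσ₀ hG
  have hx : IsUnit (X 0 0) := by
    rw [Matrix.isUnit_iff_isUnit_det, Matrix.det_fin_one] at hXu; exact hXu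
  refine ⟨hx.unit, ?_⟩
  have h00 := congrFun (congrFun hX 0) 0
  rw [Matrix.mul_apply, Fin.sum_univ_one, Matrix.of_apply, RingHom.mapMatrix_apply, Matrix.map_apply] at h00
  rw [hx.unit_spec]
  -- `X₀₀ = u⁻¹ σ₀(X₀₀)` ⇒ `σ₀(X₀₀) = u X₀₀`
  have hu : algebraMap 𝒪[F] (maxUnramifiedCompletion F) (u : 𝒪[F]) * a = 1 := by
    rw [← map_mul, Units.mul_inv, map_one]
  calc maxUnramifiedCompletion.galAut F σ₀ (X 0 0)
      = (algebraMap 𝒪[F] (maxUnramifiedCompletion F) (u : 𝒪[F]) * a) *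
          (maxUnramifiedCompletion.galAut F σ₀).toRingHom (X 0 0) := by rw [hu, one_mul]; rfl
    _ = algebraMap 𝒪[F] (maxUnramifiedCompletion F) (u : 𝒪[F]) * X 0 0 := by rw [mul_assoc, ← h00]

variable {σ₀ : absoluteGaloisGroup F} (hσ₀ : IsAbsArithFrob σ₀) (u : 𝒪[F]ˣ)
  {ε : (maxUnramifiedCompletion F)ˣ}
  (hε : maxUnramifiedCompletion.galAut F σ₀ (ε : maxUnramifiedCompletion F) =
    algebraMap 𝒪[F] (maxUnramifiedCompletion F) (u : 𝒪[F]) * (ε : maxUnramifiedCompletion F))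

/-- **Lubin–Tate's `ϑ` over `𝒪̂_{F^nr}`** comparing the Lubin–Tate polynomials `f = πX + X^q` and
`f' = π'X + X^q`, `π' = uπ`: `ϑ ≡ εX (mod deg 2)`, `f' ∘ ϑ = ϑ^{σ₀} ∘ f`.
[cite: LubinTate1965, Lemma p. 385] [cite: CasselsFrohlichANT1967, Ch. VI §3.7 Lemma 1] -/
def ltComparison : PowerSeries (maxUnramifiedCompletion F) :=
  haveI := isAdicComplete_span_unrPi hπ
  compSeries (u₀ := u) (algebraMap 𝒪[F] (maxUnramifiedCompletion F))
    (maxUnramifiedCompletion.galAut F σ₀).toRingHom (isTwistBase_galAut hπ hσ₀)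
    (isLTSeries_ltPoly F (π := π)) (isLTSeries_ltPoly F (π := (u : 𝒪[F]) * π)) (ε := ε) hε

/-- `ϑ` has no constant term. [cite: LubinTate1965, Lemma p. 385] -/
theorem constantCoeff_ltComparison : PowerSeries.constantCoeff (ltComparison hπ hσ₀ u hε) = 0 := by
  haveI := isAdicComplete_span_unrPi hπ
  exact constantCoeff_compSeries _ _ _ _ _ _

/-- `ϑ ≡ εX (mod deg 2)`. [cite: LubinTate1965, Lemma p. 385] -/
theorem coeff_one_ltComparison : PowerSeries.coeff 1 (ltComparison hπ hσ₀ u hε) = ε := by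
  haveI := isAdicComplete_span_unrPi hπ
  exact coeff_one_compSeries _ _ _ _ _ _

/-- **`f' ∘ ϑ = ϑ^{σ₀} ∘ f`.** [cite: LubinTate1965, Lemma p. 385] -/
theorem subst_ltComparison :
    PowerSeries.subst (ltComparison hπ hσ₀ u hε)
        (((ltPoly F ((u : 𝒪[F]) * π) : Polynomial 𝒪[F]) : PowerSeries 𝒪[F]).map
          (algebraMap 𝒪[F] (maxUnramifiedCompletion F))) =
      PowerSeries.subst
        (((ltPoly F π : Polynomial 𝒪[F]) : PowerSeries 𝒪[F]).map (algebraMap 𝒪[F] (maxUnramifiedCompletion F)))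
        (PowerSeries.map (maxUnramifiedCompletion.galAut F σ₀).toRingHom (ltComparison hπ hσ₀ u hε)) := by
  haveI := isAdicComplete_span_unrPi hπ
  exact subst_compSeries _ _ _ _ _ _

/-- **`ϑ^{σ₀} = ϑ ∘ [u]_f`.** [cite: LubinTate1965, Lemma p. 385, (16)] -/
theorem map_ltComparison :
    PowerSeries.map (maxUnramifiedCompletion.galAut F σ₀).toRingHom (ltComparison hπ hσ₀ u hε) =
      PowerSeries.subst ((hom (isLTRing_integer F hπ) (isLTSeries_ltPoly F) (isLTSeries_ltPoly F) (u : 𝒪[F])).map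
        (algebraMap 𝒪[F] (maxUnramifiedCompletion F))) (ltComparison hπ hσ₀ u hε) := by
  haveI := isAdicComplete_span_unrPi hπ
  exact map_compSeries _ _ _ (fun a => maxUnramifiedCompletion.galAut_algebraMap σ₀ a) _ _ _ _

include hπ in
/-- `uπ` is again a uniformiser for `u ∈ 𝒪_Fˣ`. [folklore] -/
theorem isUniformizer_unit_mul : (valuation F).IsUniformizer ((((u : 𝒪[F]) * π : 𝒪[F]) : F)) := by
  show (valuation F).IsUniformizer (((u : 𝒪[F]) : F) * (π : F))
  have hu : valuation F ((u : 𝒪[F]) : F) = 1 :=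
    (Valuation.integer.integers (valuation F)).one_of_isUnit u.isUnit
  rw [Valuation.IsUniformizer, map_mul, hu, one_mul]
  exact hπ

include hπ in
/-- `(𝒪[F], uπ, q)` is a Lubin–Tate base as well (`uπ` is again a uniformiser). [folklore] -/
theorem isLTRing_unit_mul : IsLTRing ((u : 𝒪[F]) * π) (residueFieldCard F) :=
  isLTRing_integer F (isUniformizer_unit_mul hπ u)

/-- **`ϑ ∘ [a]_f = [a]_{f'} ∘ ϑ`** for `a ∈ 𝒪_F`. [cite: LubinTate1965, Lemma p. 385, (18)] -/
theorem subst_hom_ltComparison (a : 𝒪[F]) :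
    PowerSeries.subst ((hom (isLTRing_integer F hπ) (isLTSeries_ltPoly F) (isLTSeries_ltPoly F) a).map
        (algebraMap 𝒪[F] (maxUnramifiedCompletion F))) (ltComparison hπ hσ₀ u hε) =
      PowerSeries.subst (ltComparison hπ hσ₀ u hε)
        ((hom (isLTRing_unit_mul hπ u) (isLTSeries_ltPoly F (π := (u : 𝒪[F]) * π))
          (isLTSeries_ltPoly F (π := (u : 𝒪[F]) * π)) a).map (algebraMap 𝒪[F] (maxUnramifiedCompletion F))) := by
  haveI := isAdicComplete_span_unrPi hπ
  exact subst_hom_compSeries _ _ _ (fun a => maxUnramifiedCompletion.galAut_algebraMap σ₀ a) _ _ _ _ _ _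

end Unramified

end Literature.NumberTheory.GaloisRepresentations

end
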